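import Literature.LinearAlgebra.Matrix.UnitQuaternionPairsOntoSO4
import Literature.LinearAlgebra.Matrix.SimultaneousConjugacyProducts
import HarnessLib

/-!
# `SO(4)` is acceptable: families with conjugate products are simultaneously conjugate in `SO(4)`
# ([Yu2021] Thm 1.1 ∕ Thm 4.1(3); [Sengupta1994] Thm 2 form) — the positive cell of the lineage's census

statement-level skeleton of published theorems with citation tags; proofs where landed; nothing here is a claim about
the Yang–Mills mass gap

Cell `lit-balaban`, unit p24 gen 21, file 4 (own-lane free target of the Lie ∕ linear-algebra lineage, G.5-34(d); no SKELETON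
row).  The lineage's census of «conjugacy classes of all products determine the simultaneous conjugacy class» (the group
property `ProdConjDetermined`, [Sengupta1994] Thm 2: `U(n)`, `SU(n)`, `O(n)`, `SO(2n+1)`, abelian, products — tree theorems;
FALSE for `SO(2m)`, every `m ≥ 3`: `Balaban1983to89/WilsonLoopsNotCompleteEvenOrthogonal`, [Weidner2020] Prop. 4.5,
[Larsen1994] Prop. 3.8) has one remaining classical cell, `SO(4)`, and there the answer is POSITIVE: [Yu2021] Thm 1.1
(«a compact Lie group G is acceptable … SO(4)») — element-conjugate homomorphisms into `SO(4)` are globally conjugate.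
[Yu2021] proves it through the strongly controlling pair `SO(4) ⊂ G₂` (Thm 4.1(3)); this file gives an ELEMENTARY quaternionic
proof of the [Sengupta1994]-form statement `ProdConjDetermined SO(4)` (which implies acceptability for every source group,
`exists_conj_of_forall_isConj`), using the tree's `S³ × S³ ↠ SO(4)` (`UnitQuaternionPairsOntoSO4`), `S³ ↠ SO(3)`
(`RotationGroupSO3`) and [Sengupta1994] Thm 2 for `O(4)` and `O(3)` (`orthogonalGroup_exists_conj_of_prod_conj`).

PROOF (ours).  Let `V, W : ι → SO(4)` have conjugate non-empty products.  (A) By the `O(4)` theorem there is `y ∈ O(4)` with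
`W_i = y V_i yᵀ`; if `det y = 1` we are done.  (B) Let `det y = −1`.  Write `V_i = ψ(l_i, r_i)` (`exists_pairRot_eq`).  For a
non-empty product `P = ψ(L, R)`, an `SO(4)`-conjugator `g` of `P` to `y P yᵀ` yields `z = gᵀ y ∈ O(4)⁻` CENTRALISING `P`;
`z = ψ(a, b)·C` with `C = diag(1,−1,−1,−1)` the matrix of quaternion conjugation, and `C ψ(L, R) C = ψ(R, L)`, so
`ψ(a R ā, b L b̄) = ψ(L, R)`, whence `re L = ± re R` (`ψ` is injective up to a common sign).  Unit quaternions with equal real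
parts are conjugate (`exists_unit_conj_of_re_eq`), so `quatRot R` and `quatRot L` are conjugate in `O(3)` for EVERY non-empty
product; the `O(3)` theorem gives `T ∈ O(3)` with `quatRot r_i = T quatRot l_i Tᵀ` for all `i`, `T ∈ SO(3)` after a sign
(`3` is odd), `T = quatRot c` (`surjective_rotHom`), hence `r_i = ±_i c l_i c̄`.  Then `Y = ψ(c̄, c)·C ∈ O(4)⁻` centralises
every `V_i`, and `g = y Y ∈ SO(4)` conjugates `V` to `W`.

* `specialOrthogonalGroup_four_exists_conj_of_prod_conj` — the theorem ([Sengupta1994] Thm 2 form for `SO(4)`);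
  `prodConjDetermined_specialOrthogonalGroup_four : ProdConjDetermined SO(4)`;
* `exists_conj_of_forall_isConj` — ACCEPTABILITY: for every group `Γ` (finite `Γ` is [Larsen1994] §0 ∕ [Yu2021] Def. 2.1
  «acceptable», compact `Γ` is [Yu2021] Def. 2.1 «strongly acceptable»; here `Γ` is arbitrary), element-conjugate homomorphisms
  `φ, ψ : Γ →* SO(4)` are globally conjugate — [Yu2021] Thm 1.1 ∕ Thm 4.1(3) for `SO(4)`; `exists_conj_of_forall_prod_isConj`
  (families: all products conjugate ⟹ simultaneously conjugate);
* tools: `pairRot_transpose`, `conjMat` (+ `conjMat_mul_pairRot_mul_conjMat`), `eq_or_eq_of_pairRot_eq`, `quatRot_transpose`,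
  `eq_or_eq_neg_of_quatRot_eq`, `exists_unit_conj_of_re_eq` (unit quaternions with equal real part are conjugate),
  `exists_orthogonal_conj_quatRot`.

HONEST SCOPE.  `SO(4) = Matrix.specialOrthogonalGroup (Fin 4) ℝ`; index types in any universe (`ProdConjDetermined.{0, v}`).
The hypothesis is conjugacy IN `SO(4)` of all non-empty positive products (Sengupta's form), which for homomorphisms
`Γ →* SO(4)` is element-conjugacy; nothing about `G₂`, nothing about Yu's other groups; NOT summit progress.  The lattice ∕
Wilson-loop consequences (class functions of loop products DO separate gauge orbits for `SO(4)`) are left to a successor.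

## References

* [Yu2021] J. Yu, *Acceptable compact Lie groups*, Peking Math. J. 5 (2021) 427–446, Thm 1.1 (classification; `SO(4)`
  acceptable), Thm 4.1(3).  Held: `paper:arxiv-1806.06316`.
* [Larsen1994] M. Larsen, *On the conjugacy of element-conjugate homomorphisms*, Israel J. Math. 88 (1994) 253–277 (the notion
  «acceptable»; Prop. 3.8 ∕ Thm 3.12: `SO(2n)`, `n ≥ 4`, unacceptable).
* [Sengupta1994] A. Sengupta, Proc. AMS 121 (1994), Thm 2 p.900 (the product form; tree theorems for `O(n)`).
* [EbbinghausEtAl1991] Ch. 7 §3 (quaternionic `SO(3)`, `SO(4)`; tree files re-used).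
-/

noncomputable section

open Quaternion Matrix
open scoped Quaternion

namespace Literature.LinearAlgebra.Matrix.SimultaneousConjugacySO4

open Literature.AlgebraicTopology.FundamentalGroup (SO3 quatRot quatRot_one quatRot_neg quatRot_mul
  transpose_quatRot_mul_self rotHom coe_rotHom surjective_rotHom eq_one_or_eq_neg_one_of_quatRot_eq_one normSq_coe_sphere)
open Literature.LinearAlgebra.Matrix.UnitQuaternionPairsOntoSO4

universe v

/-! ## §0 Membership helpers -/

section Helpers

/-- For a real matrix `star = transpose`. [folklore] -/
private theorem star_eq_transpose' {n : ℕ} (A : Matrix (Fin n) (Fin n) ℝ) : star A = Aᵀ := by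
  rw [Matrix.star_eq_conjTranspose, Matrix.conjTranspose_eq_transpose_of_trivial]

/-- Membership in Mathlib's `SO(4)`. [folklore] -/
private theorem mem_SO4_iff (A : Matrix (Fin 4) (Fin 4) ℝ) :
    A ∈ Matrix.specialOrthogonalGroup (Fin 4) ℝ ↔ Aᵀ * A = 1 ∧ A.det = 1 := by
  rw [Matrix.mem_specialOrthogonalGroup_iff, Matrix.mem_unitaryGroup_iff', star_eq_transpose']

/-- Membership in Mathlib's `O(n)`. [folklore] -/
private theorem mem_O_iff {n : ℕ} (A : Matrix (Fin n) (Fin n) ℝ) : A ∈ Matrix.orthogonalGroup (Fin n) ℝ ↔ Aᵀ * A = 1 := by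
  rw [Matrix.mem_unitaryGroup_iff', star_eq_transpose']

end Helpers

/-! ## §1 More algebra of `ψ(a, b) = pairRot a b`: transpose, the conjugation matrix `C`, injectivity up to sign -/

section PairRotAlgebra

/-- **`ψ(a, b)ᵀ = ψ(ā, b̄)`** (the adjoint of `x ↦ a x b̄` is `y ↦ ā y b`). [cite: EbbinghausEtAl1991, Ch. 7 §3.4 (ψ(a,b) orthogonal: ψ(a,b)⁻¹ = ψ(a⁻¹, b⁻¹) = ψ(ā, b̄) for unit a, b)] -/
theorem pairRot_transpose (a b : ℍ) : (pairRot a b)ᵀ = pairRot (star a) (star b) := by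
  ext i j
  simp only [Matrix.transpose_apply, pairRot, Matrix.of_apply]
  fin_cases i <;> fin_cases j <;> simp [coord, e4] <;> ring

/-- **THE MATRIX `C = diag(1, −1, −1, −1)` OF QUATERNION CONJUGATION `x ↦ x̄`** (an orthogonal map of determinant `−1`).
[cite: EbbinghausEtAl1991, Ch. 7 §3.2 (the mappings x ↦ a x̄ b, O⁻(ℍ))] -/
def conjMat : Matrix (Fin 4) (Fin 4) ℝ := Matrix.diagonal ![1, -1, -1, -1]

/-- `C` acts as `x ↦ x̄` on coordinates. [cite: EbbinghausEtAl1991, Ch. 7 §3.2 (x ↦ x̄)] -/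
theorem conjMat_mulVec (x : ℍ) : conjMat *ᵥ coord x = coord (star x) := by
  ext i
  fin_cases i <;> simp [conjMat, coord, Matrix.mulVec_diagonal]

/-- `C² = 1`. [cite: EbbinghausEtAl1991, Ch. 7 §3.2 (x ↦ x̄ is an involution)] -/
theorem conjMat_mul_conjMat : conjMat * conjMat = 1 := by
  rw [conjMat, Matrix.diagonal_mul_diagonal, ← Matrix.diagonal_one]
  congr 1
  funext i
  fin_cases i <;> simp

/-- `Cᵀ = C`. [cite: EbbinghausEtAl1991, Ch. 7 §3.2 (x ↦ x̄)] -/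
theorem conjMat_transpose : conjMatᵀ = conjMat := Matrix.diagonal_transpose _

/-- `det C = −1`: conjugation reverses orientation. [cite: EbbinghausEtAl1991, Ch. 7 §3.2 (x ↦ a x̄ b ∈ O⁻(ℍ))] -/
theorem det_conjMat : conjMat.det = -1 := by
  rw [conjMat, Matrix.det_diagonal, Fin.prod_univ_four]
  simp

/-- **`C ψ(a, b) C = ψ(b, a)`**: `conj ∘ (x ↦ a x b̄) ∘ conj = (x ↦ b x ā)`. [cite: EbbinghausEtAl1991, Ch. 7 §3.2 (x ↦ a x̄ b; (a x b̄)‾ = b x̄ ā)] -/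
theorem conjMat_mul_pairRot_mul_conjMat (a b : ℍ) : conjMat * pairRot a b * conjMat = pairRot b a := by
  -- v1.1 (build hygiene): the matrices agree on every coordinate vector `coord x` — `C ψ(a,b) C x = (a x̄ b̄)‾ = b x ā`;
  -- replaces the 16-case entrywise computation (≈ 190k heartbeats, < 10 % headroom under the tree's 200k budget).
  refine Matrix.ext_iff_mulVec.2 fun v => ?_
  rw [← coord_ofCoord v, ← Matrix.mulVec_mulVec, ← Matrix.mulVec_mulVec, conjMat_mulVec, pairRot_mulVec, conjMat_mulVec,
    pairRot_mulVec, star_mul, star_mul, star_star, star_star, mul_assoc]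

/-- **`ψ` IS INJECTIVE UP TO A COMMON SIGN** on unit quaternions: `ψ(a, b) = ψ(a', b')` forces `(a, b) = ±(a', b')`.
[cite: EbbinghausEtAl1991, Ch. 7 §3.4 Theorem (kernel ψ = {±(e,e)})] -/
theorem eq_or_eq_of_pairRot_eq {a b a' b' : ℍ} (ha : normSq a = 1) (hb : normSq b = 1) (ha' : normSq a' = 1)
    (hb' : normSq b' = 1) (h : pairRot a b = pairRot a' b') : (a = a' ∧ b = b') ∨ (a = -a' ∧ b = -b') := by
  have h1 : pairRot (star a' * a) (star b' * b) = 1 := by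
    rw [pairRot_mul, ← pairRot_transpose, ← h, transpose_mul_self, ha, hb, mul_one, one_smul]
  have hu : normSq (star a' * a) = 1 := by rw [map_mul, normSq_star, ha', ha, mul_one]
  have hv : normSq (star b' * b) = 1 := by rw [map_mul, normSq_star, hb', hb, mul_one]
  have key : ∀ {p q : ℍ}, normSq p = 1 → ∀ s : ℍ, star p * q = s → q = p * s := fun {p q} hp s hs => by
    rw [← hs, ← mul_assoc, Quaternion.self_mul_star, hp, Quaternion.coe_one, one_mul]
  rcases eq_or_eq_of_pairRot_eq_one hu hv h1 with ⟨h2, h3⟩ | ⟨h2, h3⟩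
  · exact Or.inl ⟨by rw [key ha' 1 h2, mul_one], by rw [key hb' 1 h3, mul_one]⟩
  · exact Or.inr ⟨by rw [key ha' (-1) h2, mul_neg, mul_one], by rw [key hb' (-1) h3, mul_neg, mul_one]⟩

/-- The real part is a class function: `re(c x c̄) = |c|² re x`. [cite: EbbinghausEtAl1991, Ch. 7 §3.3 (x ↦ a x ā fixes ℝe and maps Im ℍ to itself)] -/
theorem re_conj_eq (c x : ℍ) : (c * x * star c).re = normSq c * x.re := by
  simp only [Quaternion.re_mul, Quaternion.imI_mul, Quaternion.imJ_mul, Quaternion.imK_mul, Quaternion.re_star,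
    Quaternion.imI_star, Quaternion.imJ_star, Quaternion.imK_star, normSq_def']
  ring

end PairRotAlgebra

/-! ## §2 `quatRot`: transpose and injectivity up to sign -/

section QuatRotAlgebra

/-- `(quatRot q)ᵀ = quatRot q̄`. [cite: HatcherAT2002, §3.D (u ↦ (w ↦ u w u⁻¹); u⁻¹ = ū on S³)] -/
theorem quatRot_transpose (q : ℍ) : (quatRot q)ᵀ = quatRot (star q) := by
  ext i j
  fin_cases i <;> fin_cases j <;> simp [quatRot] <;> ring

/-- `quatRot q ∈ O(3)` for a unit quaternion. [cite: HatcherAT2002, §3.D (S³ → SO(3))] -/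
theorem quatRot_mem_orthogonalGroup {q : ℍ} (hq : normSq q = 1) : quatRot q ∈ Matrix.orthogonalGroup (Fin 3) ℝ :=
  (mem_O_iff _).2 (by rw [transpose_quatRot_mul_self, hq, one_pow, one_smul])

/-- **`quatRot` is injective up to sign** on unit quaternions. [cite: HatcherAT2002, §3.D (kernel ℤ₂ = {±1})] -/
theorem eq_or_eq_neg_of_quatRot_eq {p q : ℍ} (hp : normSq p = 1) (hq : normSq q = 1) (h : quatRot p = quatRot q) :
    p = q ∨ p = -q := by
  have h1 : quatRot (star q * p) = 1 := by
    rw [quatRot_mul, ← quatRot_transpose, ← h, transpose_quatRot_mul_self, hp, one_pow, one_smul]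
  have hu : normSq (star q * p) = 1 := by rw [map_mul, normSq_star, hq, hp, mul_one]
  have key : ∀ s : ℍ, star q * p = s → p = q * s := fun s hs => by
    rw [← hs, ← mul_assoc, Quaternion.self_mul_star, hq, Quaternion.coe_one, one_mul]
  rcases eq_one_or_eq_neg_one_of_quatRot_eq_one hu h1 with h2 | h2
  · exact Or.inl (by rw [key 1 h2, mul_one])
  · exact Or.inr (by rw [key (-1) h2, mul_neg, mul_one])

end QuatRotAlgebra

/-! ## §3 Unit quaternions with equal real parts are conjugate -/

section QuaternionConjugacy

/-- Normalising an intertwiner: `c p = q c` with `c ≠ 0` gives a unit `c'` with `c' p c̄' = q`. [folklore] -/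
private theorem exists_unit_conj_of_mul_eq {c p q : ℍ} (hc : c ≠ 0) (h : c * p = q * c) :
    ∃ c' : ℍ, normSq c' = 1 ∧ c' * p * star c' = q := by
  have hn : 0 < normSq c := lt_of_le_of_ne normSq_nonneg (fun h0 => hc (normSq_eq_zero.1 h0.symm))
  set s : ℝ := Real.sqrt (normSq c) with hs
  have hss : s * s = normSq c := Real.mul_self_sqrt normSq_nonneg
  have hs0 : s ≠ 0 := (Real.sqrt_pos.2 hn).ne'
  refine ⟨(s⁻¹ : ℝ) • c, ?_, ?_⟩
  · rw [Quaternion.normSq_smul, ← hss]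
    field_simp
  · rw [Quaternion.star_smul, smul_mul_assoc, smul_mul_assoc, mul_smul_comm, h, mul_assoc, Quaternion.self_mul_star,
      Quaternion.mul_coe_eq_smul, smul_smul, smul_smul, ← hss]
    field_simp
    rw [one_smul]

/-- **UNIT QUATERNIONS WITH THE SAME REAL PART ARE CONJUGATE IN `S³`**: `|p| = |q| = 1`, `re p = re q` ⟹ `q = c p c̄` for a
unit `c` (the conjugacy classes of `S³ ≅ SU(2)` are the level sets of the real part ∕ trace; equivalently `SO(3) = φ(S³)`
acts transitively on the spheres of `Im ℍ`).  Proof: with `p = t + u`, `q = t + v`, the quaternion `c = |u|² − v u`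
satisfies `c u = v c`; if it vanishes then `v = −u` and a unit pure quaternion anticommuting with `u` does it.
[cite: EbbinghausEtAl1991, Ch. 7 §3.3 Hamilton's Theorem with §3.4 (φ(S³) = SO(Im ℍ), transitive on spheres)] -/
theorem exists_unit_conj_of_re_eq {p q : ℍ} (hp : normSq p = 1) (hq : normSq q = 1) (h : p.re = q.re) :
    ∃ c : ℍ, normSq c = 1 ∧ c * p * star c = q := by
  obtain ⟨t, p1, p2, p3⟩ := p
  obtain ⟨t', q1, q2, q3⟩ := q
  change t = t' at h
  subst h
  rw [normSq_def'] at hp hq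
  dsimp only at hp hq
  have hS : p1 ^ 2 + p2 ^ 2 + p3 ^ 2 = q1 ^ 2 + q2 ^ 2 + q3 ^ 2 := by linarith
  -- the candidate intertwiner `c₀ = |u|² − v u = (|u|² + ⟨u,v⟩) + u × v`
  let c₀ : ℍ := ⟨p1 ^ 2 + p2 ^ 2 + p3 ^ 2 + (p1 * q1 + p2 * q2 + p3 * q3), p2 * q3 - p3 * q2, p3 * q1 - p1 * q3,
    p1 * q2 - p2 * q1⟩
  by_cases hc : c₀ = 0
  · -- then `v = -u`, i.e. `q = p̄`
    have h0 := congrArg (fun x : ℍ => x.re) hc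
    have h1 := congrArg (fun x : ℍ => x.imI) hc
    have h2 := congrArg (fun x : ℍ => x.imJ) hc
    have h3 := congrArg (fun x : ℍ => x.imK) hc
    simp only [c₀, Quaternion.re_zero, Quaternion.imI_zero, Quaternion.imJ_zero, Quaternion.imK_zero] at h0 h1 h2 h3
    have hsum : (p1 + q1) ^ 2 + (p2 + q2) ^ 2 + (p3 + q3) ^ 2 = 0 := by linear_combination 2 * h0 - hS
    have e1 : q1 = -p1 := by nlinarith [sq_nonneg (p1 + q1), sq_nonneg (p2 + q2), sq_nonneg (p3 + q3)]
    have e2 : q2 = -p2 := by nlinarith [sq_nonneg (p1 + q1), sq_nonneg (p2 + q2), sq_nonneg (p3 + q3)]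
    have e3 : q3 = -p3 := by nlinarith [sq_nonneg (p1 + q1), sq_nonneg (p2 + q2), sq_nonneg (p3 + q3)]
    subst e1 e2 e3
    by_cases h23 : p2 = 0 ∧ p3 = 0
    · -- `u ∈ ℝ i`: the unit `j` anticommutes with `u`
      obtain ⟨rfl, rfl⟩ := h23
      refine ⟨⟨0, 0, 1, 0⟩, by rw [normSq_def']; norm_num, ?_⟩
      ext <;> simp
    · -- `w = (0, 0, p₃, −p₂) = u × i ≠ 0` anticommutes with `u`
      have hw : (⟨0, 0, p3, -p2⟩ : ℍ) ≠ 0 := by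
        intro h0
        have h2' : p3 = 0 := congrArg (fun x : ℍ => x.imJ) h0
        have h3' : -p2 = 0 := congrArg (fun x : ℍ => x.imK) h0
        exact h23 ⟨neg_eq_zero.1 h3', h2'⟩
      exact exists_unit_conj_of_mul_eq hw (by ext <;> simp <;> ring)
  · exact exists_unit_conj_of_mul_eq hc (by
      ext <;> simp [c₀]
      · ring
      · linear_combination p1 * hS
      · linear_combination p2 * hS
      · linear_combination p3 * hS)

/-- **`quatRot p` AND `quatRot q` ARE CONJUGATE IN `O(3)` WHEN `(re p)² = (re q)²`** (unit `p, q`): by the previous lemma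
(after `q ↦ −q` if necessary, `quatRot (−q) = quatRot q`), with the conjugator `quatRot c`. [cite: EbbinghausEtAl1991, Ch. 7 §3.3–3.4 (φ(a) φ(p) φ(a)⁻¹ = φ(a p ā))] -/
theorem exists_orthogonal_conj_quatRot {p q : ℍ} (hp : normSq p = 1) (hq : normSq q = 1) (h : p.re ^ 2 = q.re ^ 2) :
    ∃ T : Matrix (Fin 3) (Fin 3) ℝ, T ∈ Matrix.orthogonalGroup (Fin 3) ℝ ∧ quatRot q = T * quatRot p * star T := by
  -- reduce to equal real parts
  suffices H : ∀ q' : ℍ, normSq q' = 1 → p.re = q'.re →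
      ∃ T : Matrix (Fin 3) (Fin 3) ℝ, T ∈ Matrix.orthogonalGroup (Fin 3) ℝ ∧ quatRot q' = T * quatRot p * star T by
    rcases sq_eq_sq_iff_eq_or_eq_neg.1 h with h1 | h1
    · exact H q hq h1
    · obtain ⟨T, hT, hc⟩ := H (-q) (by rw [normSq_neg, hq]) (by rw [Quaternion.re_neg, ← h1])
      exact ⟨T, hT, by rw [← quatRot_neg, hc]⟩
  intro q' hq' h'
  obtain ⟨c, hc1, hc⟩ := exists_unit_conj_of_re_eq hp hq' h'
  refine ⟨quatRot c, quatRot_mem_orthogonalGroup hc1, ?_⟩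
  rw [star_eq_transpose', quatRot_transpose, ← quatRot_mul, ← quatRot_mul, hc]

end QuaternionConjugacy

/-! ## §4 The theorem -/

section Main

variable {ι : Type*}

/-- List products of `ψ`'s. [cite: EbbinghausEtAl1991, Ch. 7 §3.4 Theorem (ψ is a homomorphism)] -/
private theorem prod_map_pairRot (f g : ι → ℍ) (l : List ι) :
    (l.map fun i => pairRot (f i) (g i)).prod = pairRot (l.map f).prod (l.map g).prod := by
  induction l with
  | nil => simp
  | cons a l ih => rw [List.map_cons, List.prod_cons, List.map_cons, List.prod_cons, List.map_cons, List.prod_cons, ih,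
      ← pairRot_mul]

/-- List products of `quatRot`'s. [folklore] -/
private theorem prod_map_quatRot (f : ι → ℍ) (l : List ι) :
    (l.map fun i => quatRot (f i)).prod = quatRot (l.map f).prod := by
  induction l with
  | nil => simp
  | cons a l ih => rw [List.map_cons, List.prod_cons, List.map_cons, List.prod_cons, ih, ← quatRot_mul]

/-- Products of unit quaternions are unit. [folklore] -/
private theorem normSq_prod (f : ι → ℍ) (hf : ∀ i, normSq (f i) = 1) (l : List ι) : normSq (l.map f).prod = 1 := by
  induction l with
  | nil => simp
  | cons a l ih => rw [List.map_cons, List.prod_cons, map_mul, hf, ih, one_mul]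

/-- Conjugating every factor conjugates the product. [folklore] -/
private theorem prod_map_conj (y : Matrix (Fin 4) (Fin 4) ℝ) (hy : star y * y = 1) (hy' : y * star y = 1)
    (f : ι → Matrix (Fin 4) (Fin 4) ℝ) (l : List ι) :
    (l.map fun i => y * f i * star y).prod = y * (l.map f).prod * star y := by
  induction l with
  | nil => simp [hy']
  | cons a l ih =>
    rw [List.map_cons, List.prod_cons, List.map_cons, List.prod_cons, ih]
    calc y * f a * star y * (y * (l.map f).prod * star y)
        = y * f a * (star y * y) * (l.map f).prod * star y := by simp only [Matrix.mul_assoc]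
      _ = y * (f a * (l.map f).prod) * star y := by rw [hy, Matrix.mul_one, Matrix.mul_assoc y]

/-- Coercion of a list product in `SO(4)`. [folklore] -/
private theorem coe_list_prod_SO4 (V : ι → Matrix.specialOrthogonalGroup (Fin 4) ℝ) (l : List ι) :
    ((l.map V).prod : Matrix (Fin 4) (Fin 4) ℝ) = (l.map fun i => (V i : Matrix (Fin 4) (Fin 4) ℝ)).prod := by
  rw [Submonoid.coe_list_prod, List.map_map]
  rfl

/-- Coercion of a list product in `O(3)`. [folklore] -/
private theorem coe_list_prod_O3 (A : ι → Matrix.orthogonalGroup (Fin 3) ℝ) (l : List ι) :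
    ((l.map A).prod : Matrix (Fin 3) (Fin 3) ℝ) = (l.map fun i => (A i : Matrix (Fin 3) (Fin 3) ℝ)).prod := by
  rw [Submonoid.coe_list_prod, List.map_map]
  rfl

/-- **[Yu2021] THM 1.1 FOR `SO(4)`, IN [Sengupta1994] THM 2 FORM: `SO(4)` HAS THE PRODUCT-CONJUGACY PROPERTY.**  If
`V, W : ι → SO(4)` are families such that every non-empty product `W_{a₁}⋯W_{a_k}` is conjugate in `SO(4)` to
`V_{a₁}⋯V_{a_k}`, then `W_a = y V_a y⁻¹` for ONE `y ∈ SO(4)` and all `a`.  (Elementary quaternionic proof, see the module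
docstring; [Yu2021] obtains acceptability of `SO(4)` from `SO(4) ⊂ G₂`.) [cite: Yu2021, Thm 1.1 (SO(4) acceptable) and Thm 4.1(3); Sengupta1994, Thm 2 p.900 (form of the statement)] -/
theorem specialOrthogonalGroup_four_exists_conj_of_prod_conj (V W : ι → Matrix.specialOrthogonalGroup (Fin 4) ℝ)
    (h : ∀ l : List ι, l ≠ [] →
      ∃ y : Matrix.specialOrthogonalGroup (Fin 4) ℝ, (l.map W).prod = y * (l.map V).prod * y⁻¹) :
    ∃ y : Matrix.specialOrthogonalGroup (Fin 4) ℝ, ∀ i, W i = y * V i * y⁻¹ := by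
  -- (A) an `O(4)`-conjugator ([Sengupta1994] Thm 2 for `O(4)`)
  have hle : Matrix.specialOrthogonalGroup (Fin 4) ℝ ≤ Matrix.orthogonalGroup (Fin 4) ℝ :=
    Matrix.specialUnitaryGroup_le_unitaryGroup
  let V' : ι → Matrix.orthogonalGroup (Fin 4) ℝ := fun i => ⟨V i, hle (V i).2⟩
  let W' : ι → Matrix.orthogonalGroup (Fin 4) ℝ := fun i => ⟨W i, hle (W i).2⟩
  have hcoeV : ∀ l : List ι, ((l.map V').prod : Matrix (Fin 4) (Fin 4) ℝ) = ((l.map V).prod : Matrix (Fin 4) (Fin 4) ℝ) := by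
    intro l
    rw [Submonoid.coe_list_prod, Submonoid.coe_list_prod, List.map_map, List.map_map]
    rfl
  have hcoeW : ∀ l : List ι, ((l.map W').prod : Matrix (Fin 4) (Fin 4) ℝ) = ((l.map W).prod : Matrix (Fin 4) (Fin 4) ℝ) := by
    intro l
    rw [Submonoid.coe_list_prod, Submonoid.coe_list_prod, List.map_map, List.map_map]
    rfl
  have h' : ∀ l : List ι, l ≠ [] →
      ∃ y : Matrix.orthogonalGroup (Fin 4) ℝ, (l.map W').prod = y * (l.map V').prod * y⁻¹ := by
    intro l hl
    obtain ⟨y, hy⟩ := h l hl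
    refine ⟨⟨y, hle y.2⟩, Subtype.ext ?_⟩
    have hy' := congrArg (Subtype.val : Matrix.specialOrthogonalGroup (Fin 4) ℝ → Matrix (Fin 4) (Fin 4) ℝ) hy
    rw [hcoeW, hy']
    change (y : Matrix (Fin 4) (Fin 4) ℝ) * ((l.map V).prod : Matrix (Fin 4) (Fin 4) ℝ)
        * ((y⁻¹ : Matrix.specialOrthogonalGroup (Fin 4) ℝ) : Matrix (Fin 4) (Fin 4) ℝ)
      = y * ((l.map V').prod : Matrix (Fin 4) (Fin 4) ℝ) * star (y : Matrix (Fin 4) (Fin 4) ℝ)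
    rw [hcoeV, ← Matrix.star_eq_inv, Matrix.specialUnitaryGroup.coe_star]
  obtain ⟨y, hy⟩ := orthogonalGroup_exists_conj_of_prod_conj V' W' h'
  have hyi : ∀ i, (W i : Matrix (Fin 4) (Fin 4) ℝ)
      = (y : Matrix (Fin 4) (Fin 4) ℝ) * (V i : Matrix (Fin 4) (Fin 4) ℝ) * star (y : Matrix (Fin 4) (Fin 4) ℝ) :=
    fun i => by
      have := congrArg (Subtype.val : Matrix.orthogonalGroup (Fin 4) ℝ → Matrix (Fin 4) (Fin 4) ℝ) (hy i)
      simpa [V', W'] using this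
  have hyO : star (y : Matrix (Fin 4) (Fin 4) ℝ) * y = 1 := Matrix.mem_unitaryGroup_iff'.mp y.2
  have hyO' : (y : Matrix (Fin 4) (Fin 4) ℝ) * star (y : Matrix (Fin 4) (Fin 4) ℝ) = 1 := Matrix.mem_unitaryGroup_iff.mp y.2
  have hdet : (y : Matrix (Fin 4) (Fin 4) ℝ).det * (y : Matrix (Fin 4) (Fin 4) ℝ).det = 1 := by
    have := (Unitary.mem_iff.mp (Matrix.det_of_mem_unitary y.2)).1
    rwa [star_trivial] at this
  -- it suffices to produce an orthogonal matrix of determinant one inducing the conjugation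
  suffices H : ∃ g : Matrix (Fin 4) (Fin 4) ℝ, g ∈ Matrix.orthogonalGroup (Fin 4) ℝ ∧ g.det = 1 ∧
      ∀ i, (W i : Matrix (Fin 4) (Fin 4) ℝ) = g * (V i : Matrix (Fin 4) (Fin 4) ℝ) * star g by
    obtain ⟨g, hgO, hgdet, hgc⟩ := H
    have hgSO : g ∈ Matrix.specialOrthogonalGroup (Fin 4) ℝ := Matrix.mem_specialUnitaryGroup_iff.mpr ⟨hgO, hgdet⟩
    refine ⟨⟨g, hgSO⟩, fun i => Subtype.ext ?_⟩
    change (W i : Matrix (Fin 4) (Fin 4) ℝ) = g * (V i : Matrix (Fin 4) (Fin 4) ℝ) *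
      ((⟨g, hgSO⟩ : Matrix.specialOrthogonalGroup (Fin 4) ℝ)⁻¹ : Matrix.specialOrthogonalGroup (Fin 4) ℝ)
    rw [← Matrix.star_eq_inv, Matrix.specialUnitaryGroup.coe_star]
    exact hgc i
  rcases mul_self_eq_one_iff.mp hdet with hy1 | hy1
  · exact ⟨y, y.2, hy1, hyi⟩
  -- (B) `det y = -1`.  Lift the generators to pairs of unit quaternions.
  choose l r hl hr hV using fun i => exists_pairRot_eq (V i).2
  have hVfun : (fun i => (V i : Matrix (Fin 4) (Fin 4) ℝ)) = fun i => pairRot (l i) (r i) := funext fun i => (hV i).symm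
  -- (B3) for every non-empty product `ψ(L, R)`: `(re L)² = (re R)²`
  have hsq : ∀ ℓ : List ι, ℓ ≠ [] → ((ℓ.map l).prod.re) ^ 2 = ((ℓ.map r).prod.re) ^ 2 := by
    intro ℓ hℓ
    obtain ⟨g, hg⟩ := h ℓ hℓ
    have hL : normSq (ℓ.map l).prod = 1 := normSq_prod l hl ℓ
    have hR : normSq (ℓ.map r).prod = 1 := normSq_prod r hr ℓ
    have hPV : (ℓ.map fun i => (V i : Matrix (Fin 4) (Fin 4) ℝ)).prod = pairRot (ℓ.map l).prod (ℓ.map r).prod := by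
      rw [hVfun, prod_map_pairRot]
    have hP : ((ℓ.map V).prod : Matrix (Fin 4) (Fin 4) ℝ) = pairRot (ℓ.map l).prod (ℓ.map r).prod := by
      rw [coe_list_prod_SO4, hPV]
    have hWP : ((ℓ.map W).prod : Matrix (Fin 4) (Fin 4) ℝ)
        = (y : Matrix (Fin 4) (Fin 4) ℝ) * pairRot (ℓ.map l).prod (ℓ.map r).prod * star (y : Matrix (Fin 4) (Fin 4) ℝ) := by
      rw [coe_list_prod_SO4, show (fun i => (W i : Matrix (Fin 4) (Fin 4) ℝ)) = fun i =>
          (y : Matrix (Fin 4) (Fin 4) ℝ) * (V i : Matrix (Fin 4) (Fin 4) ℝ) * star (y : Matrix (Fin 4) (Fin 4) ℝ) from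
        funext hyi, prod_map_conj _ hyO hyO', hPV]
    -- the `SO(4)`-conjugacy of the products, at matrix level
    have hg' : (y : Matrix (Fin 4) (Fin 4) ℝ) * pairRot (ℓ.map l).prod (ℓ.map r).prod * star (y : Matrix (Fin 4) (Fin 4) ℝ)
        = (g : Matrix (Fin 4) (Fin 4) ℝ) * pairRot (ℓ.map l).prod (ℓ.map r).prod * star (g : Matrix (Fin 4) (Fin 4) ℝ) := by
      have := congrArg (Subtype.val : Matrix.specialOrthogonalGroup (Fin 4) ℝ → Matrix (Fin 4) (Fin 4) ℝ) hg
      rw [Submonoid.coe_mul, Submonoid.coe_mul, ← Matrix.star_eq_inv, Matrix.specialUnitaryGroup.coe_star, hWP, hP] at this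
      exact this
    have hgg : star (g : Matrix (Fin 4) (Fin 4) ℝ) * g = 1 := Matrix.mem_unitaryGroup_iff'.mp (hle g.2)
    have hgg' : (g : Matrix (Fin 4) (Fin 4) ℝ) * star (g : Matrix (Fin 4) (Fin 4) ℝ) = 1 :=
      Matrix.mem_unitaryGroup_iff.mp (hle g.2)
    have hgdet : (g : Matrix (Fin 4) (Fin 4) ℝ).det = 1 := (Matrix.mem_specialUnitaryGroup_iff.mp g.2).2
    -- `z := gᵀ y ∈ O(4)⁻` centralises the product
    set P := pairRot (ℓ.map l).prod (ℓ.map r).prod with hPdef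
    set z : Matrix (Fin 4) (Fin 4) ℝ := star (g : Matrix (Fin 4) (Fin 4) ℝ) * y with hzdef
    have hzs : star z = star (y : Matrix (Fin 4) (Fin 4) ℝ) * g := by rw [hzdef, star_mul, star_star]
    have hz : z * P * star z = P := by
      rw [hzs, hzdef]
      calc star (g : Matrix (Fin 4) (Fin 4) ℝ) * y * P * (star (y : Matrix (Fin 4) (Fin 4) ℝ) * g)
          = star (g : Matrix (Fin 4) (Fin 4) ℝ) * ((y : Matrix (Fin 4) (Fin 4) ℝ) * P * star (y : Matrix (Fin 4) (Fin 4) ℝ)) * g := by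
            simp only [Matrix.mul_assoc]
        _ = star (g : Matrix (Fin 4) (Fin 4) ℝ) * g * P * (star (g : Matrix (Fin 4) (Fin 4) ℝ) * g) := by
            rw [hg']; simp only [Matrix.mul_assoc]
        _ = P := by rw [hgg, Matrix.one_mul, Matrix.mul_one]
    have hzz : star z * z = 1 := by
      rw [hzs, hzdef]
      calc star (y : Matrix (Fin 4) (Fin 4) ℝ) * g * (star (g : Matrix (Fin 4) (Fin 4) ℝ) * y)
          = star (y : Matrix (Fin 4) (Fin 4) ℝ) * ((g : Matrix (Fin 4) (Fin 4) ℝ) * star (g : Matrix (Fin 4) (Fin 4) ℝ)) * y := by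
            simp only [Matrix.mul_assoc]
        _ = 1 := by rw [hgg', Matrix.mul_one, hyO]
    have hzdet : z.det = -1 := by
      rw [hzdef, Matrix.det_mul, star_eq_transpose', Matrix.det_transpose, hgdet, hy1, one_mul]
    -- `z C ∈ SO(4)`, so `z = ψ(a, b) C`
    have hzC : z * conjMat ∈ Matrix.specialOrthogonalGroup (Fin 4) ℝ := by
      refine (mem_SO4_iff _).2 ⟨?_, ?_⟩
      · rw [Matrix.transpose_mul, conjMat_transpose, ← star_eq_transpose', Matrix.mul_assoc, ← Matrix.mul_assoc (star z),
          hzz, Matrix.one_mul, conjMat_mul_conjMat]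
      · rw [Matrix.det_mul, hzdet, det_conjMat]; norm_num
    obtain ⟨a, b, ha, hb, hab⟩ := exists_pairRot_eq hzC
    have hz' : z = pairRot a b * conjMat := by
      rw [hab, Matrix.mul_assoc, conjMat_mul_conjMat, Matrix.mul_one]
    have hconj : z * P * star z = pairRot (a * (ℓ.map r).prod * star a) (b * (ℓ.map l).prod * star b) := by
      rw [hz', star_mul, star_eq_transpose', star_eq_transpose', conjMat_transpose, pairRot_transpose, hPdef]
      calc pairRot a b * conjMat * pairRot (ℓ.map l).prod (ℓ.map r).prod * (conjMat * pairRot (star a) (star b))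
          = pairRot a b * (conjMat * pairRot (ℓ.map l).prod (ℓ.map r).prod * conjMat) * pairRot (star a) (star b) := by
            simp only [Matrix.mul_assoc]
        _ = pairRot (a * (ℓ.map r).prod * star a) (b * (ℓ.map l).prod * star b) := by
            rw [conjMat_mul_pairRot_mul_conjMat, ← pairRot_mul, ← pairRot_mul]
    rw [hconj, hPdef] at hz
    have h1 : normSq (a * (ℓ.map r).prod * star a) = 1 := by rw [map_mul, map_mul, normSq_star, ha, hR, mul_one, mul_one]
    have h2 : normSq (b * (ℓ.map l).prod * star b) = 1 := by rw [map_mul, map_mul, normSq_star, hb, hL, mul_one, mul_one]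
    rcases eq_or_eq_of_pairRot_eq h1 h2 hL hR hz with ⟨h3, -⟩ | ⟨h3, -⟩
    · have h4 : (a * (ℓ.map r).prod * star a).re = ((ℓ.map l).prod).re := congrArg (fun x : ℍ => x.re) h3
      rw [re_conj_eq, ha, one_mul] at h4
      rw [h4]
    · have h4 : (a * (ℓ.map r).prod * star a).re = (-(ℓ.map l).prod).re := congrArg (fun x : ℍ => x.re) h3
      rw [re_conj_eq, ha, one_mul, Quaternion.re_neg] at h4
      rw [← neg_sq, ← h4]
  -- (B4) the `O(3)` theorem applied to `quatRot l_i`, `quatRot r_i`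
  let A : ι → Matrix.orthogonalGroup (Fin 3) ℝ := fun i => ⟨quatRot (l i), quatRot_mem_orthogonalGroup (hl i)⟩
  let B : ι → Matrix.orthogonalGroup (Fin 3) ℝ := fun i => ⟨quatRot (r i), quatRot_mem_orthogonalGroup (hr i)⟩
  have hAB : ∀ ℓ : List ι, ℓ ≠ [] →
      ∃ T : Matrix.orthogonalGroup (Fin 3) ℝ, (ℓ.map B).prod = T * (ℓ.map A).prod * T⁻¹ := by
    intro ℓ hℓ
    obtain ⟨T, hT, hTc⟩ := exists_orthogonal_conj_quatRot (normSq_prod l hl ℓ) (normSq_prod r hr ℓ) (hsq ℓ hℓ)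
    refine ⟨⟨T, hT⟩, Subtype.ext ?_⟩
    change ((ℓ.map B).prod : Matrix (Fin 3) (Fin 3) ℝ) = T * ((ℓ.map A).prod : Matrix (Fin 3) (Fin 3) ℝ) * star T
    rw [coe_list_prod_O3, coe_list_prod_O3]
    change (ℓ.map fun i => quatRot (r i)).prod = T * (ℓ.map fun i => quatRot (l i)).prod * star T
    rw [prod_map_quatRot, prod_map_quatRot, hTc]
  obtain ⟨T, hT⟩ := orthogonalGroup_exists_conj_of_prod_conj A B hAB
  have hTi : ∀ i, quatRot (r i) = (T : Matrix (Fin 3) (Fin 3) ℝ) * quatRot (l i) * star (T : Matrix (Fin 3) (Fin 3) ℝ) :=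
    fun i => by
      have := congrArg (Subtype.val : Matrix.orthogonalGroup (Fin 3) ℝ → Matrix (Fin 3) (Fin 3) ℝ) (hT i)
      simpa [A, B] using this
  -- (B5) sign-fix `T` into `SO(3)` and lift it to a unit quaternion `c`
  have hTT : star (T : Matrix (Fin 3) (Fin 3) ℝ) * T = 1 := Matrix.mem_unitaryGroup_iff'.mp T.2
  have hTdet : (T : Matrix (Fin 3) (Fin 3) ℝ).det * (T : Matrix (Fin 3) (Fin 3) ℝ).det = 1 := by
    have := (Unitary.mem_iff.mp (Matrix.det_of_mem_unitary T.2)).1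
    rwa [star_trivial] at this
  obtain ⟨T', hT'O, hT'det, hT'c⟩ : ∃ T' : Matrix (Fin 3) (Fin 3) ℝ, T'ᵀ * T' = 1 ∧ T'.det = 1 ∧
      ∀ i, quatRot (r i) = T' * quatRot (l i) * T'ᵀ := by
    rcases mul_self_eq_one_iff.mp hTdet with h1 | h1
    · exact ⟨T, by rw [← star_eq_transpose']; exact hTT, h1, fun i => by rw [← star_eq_transpose']; exact hTi i⟩
    · refine ⟨-(T : Matrix (Fin 3) (Fin 3) ℝ), ?_, ?_, fun i => ?_⟩
      · rw [Matrix.transpose_neg, neg_mul_neg, ← star_eq_transpose']; exact hTT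
      · rw [Matrix.det_neg, h1, Fintype.card_fin]; norm_num
      · rw [Matrix.transpose_neg, neg_mul, neg_mul_neg, ← star_eq_transpose']; exact hTi i
  obtain ⟨c, hc⟩ := surjective_rotHom ⟨T', hT'O, hT'det⟩
  have hcT : quatRot (c : ℍ) = T' := congrArg Subtype.val hc
  have hc1 : normSq (c : ℍ) = 1 := normSq_coe_sphere c
  have hri : ∀ i, r i = (c : ℍ) * l i * star (c : ℍ) ∨ r i = -((c : ℍ) * l i * star (c : ℍ)) := fun i => by
    apply eq_or_eq_neg_of_quatRot_eq (hr i)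
      (by rw [map_mul, map_mul, normSq_star, hc1, hl i, mul_one, mul_one])
    rw [quatRot_mul, quatRot_mul, ← quatRot_transpose, hcT]
    exact hT'c i
  -- (B6) `Y := ψ(c̄, c) C ∈ O(4)⁻` centralises every `V i`
  set Y : Matrix (Fin 4) (Fin 4) ℝ := pairRot (star (c : ℍ)) (c : ℍ) * conjMat with hYdef
  have hsc1 : normSq (star (c : ℍ)) = 1 := by rw [normSq_star, hc1]
  have hYstar : star Y = conjMat * pairRot (c : ℍ) (star (c : ℍ)) := by
    rw [hYdef, star_mul, star_eq_transpose', star_eq_transpose', conjMat_transpose, pairRot_transpose, star_star]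
  have hcc : (c : ℍ) * star (c : ℍ) = 1 := by rw [Quaternion.self_mul_star, hc1, Quaternion.coe_one]
  have hcc' : star (c : ℍ) * (c : ℍ) = 1 := by rw [Quaternion.star_mul_self, hc1, Quaternion.coe_one]
  have hYY : star Y * Y = 1 := by
    rw [hYstar, hYdef]
    calc conjMat * pairRot (c : ℍ) (star (c : ℍ)) * (pairRot (star (c : ℍ)) (c : ℍ) * conjMat)
        = conjMat * (pairRot (c : ℍ) (star (c : ℍ)) * pairRot (star (c : ℍ)) (c : ℍ)) * conjMat := by
          simp only [Matrix.mul_assoc]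
      _ = 1 := by rw [← pairRot_mul, hcc, hcc', pairRot_one, Matrix.mul_one, conjMat_mul_conjMat]
  have hYY' : Y * star Y = 1 := mul_eq_one_comm.mp hYY
  have hYdet : Y.det = -1 := by
    rw [hYdef, Matrix.det_mul, det_pairRot, hsc1, hc1, det_conjMat]; norm_num
  have hYV : ∀ i, Y * (V i : Matrix (Fin 4) (Fin 4) ℝ) * star Y = (V i : Matrix (Fin 4) (Fin 4) ℝ) := fun i => by
    rw [← hV i, hYstar, hYdef]
    have e : pairRot (star (c : ℍ)) (c : ℍ) * conjMat * pairRot (l i) (r i) * (conjMat * pairRot (c : ℍ) (star (c : ℍ)))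
        = pairRot (star (c : ℍ) * r i * (c : ℍ)) ((c : ℍ) * l i * star (c : ℍ)) := by
      calc pairRot (star (c : ℍ)) (c : ℍ) * conjMat * pairRot (l i) (r i) * (conjMat * pairRot (c : ℍ) (star (c : ℍ)))
          = pairRot (star (c : ℍ)) (c : ℍ) * (conjMat * pairRot (l i) (r i) * conjMat) * pairRot (c : ℍ) (star (c : ℍ)) := by
            simp only [Matrix.mul_assoc]
        _ = pairRot (star (c : ℍ) * r i * (c : ℍ)) ((c : ℍ) * l i * star (c : ℍ)) := by
            rw [conjMat_mul_pairRot_mul_conjMat, ← pairRot_mul, ← pairRot_mul]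
    rw [e]
    have e2 : star (c : ℍ) * ((c : ℍ) * l i * star (c : ℍ)) * (c : ℍ) = l i := by
      calc star (c : ℍ) * ((c : ℍ) * l i * star (c : ℍ)) * (c : ℍ)
          = (star (c : ℍ) * (c : ℍ)) * l i * (star (c : ℍ) * (c : ℍ)) := by simp only [mul_assoc]
        _ = l i := by rw [hcc', one_mul, mul_one]
    rcases hri i with h2 | h2
    · rw [h2, e2]
    · rw [h2, mul_neg, neg_mul, e2, ← pairRot_neg_neg, neg_neg]
  -- (B7) `g := y Y`
  refine ⟨(y : Matrix (Fin 4) (Fin 4) ℝ) * Y, ?_, ?_, fun i => ?_⟩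
  · rw [Matrix.mem_unitaryGroup_iff, star_mul, Matrix.mul_assoc, ← Matrix.mul_assoc Y, hYY', Matrix.one_mul, hyO']
  · rw [Matrix.det_mul, hy1, hYdet]; norm_num
  · rw [hyi i, star_mul]
    conv_lhs => rw [← hYV i]
    simp only [Matrix.mul_assoc]

/-- **`ProdConjDetermined SO(4)`** — `SO(4)` joins Sengupta's list (`U(n)`, `SU(n)`, `O(n)`, `SO(2n+1)`, abelian, products:
`SimultaneousConjugacyProducts`), whereas `SO(2m)`, `m ≥ 3`, does not (`not_prodConjDetermined_specialOrthogonalGroup_even`).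
[cite: Yu2021, Thm 1.1 (SO(4) acceptable); Sengupta1994, Thm 2 p.900 (the property)] -/
theorem prodConjDetermined_specialOrthogonalGroup_four :
    ProdConjDetermined.{0, v} (Matrix.specialOrthogonalGroup (Fin 4) ℝ) :=
  fun _ V W h => specialOrthogonalGroup_four_exists_conj_of_prod_conj V W h

/-- **`SO(4)` IS (STRONGLY) ACCEPTABLE** ([Yu2021] Thm 1.1, Thm 4.1(3)): for every group `Γ` — the printed definitions take
`Γ` finite ([Larsen1994] §0: «We call a Lie group G acceptable if element-conjugacy implies global conjugacy for every finite Γ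
and every pair of homomorphisms Γ → G»; [Yu2021] Def. 2.1) or compact ([Yu2021] Def. 2.1, «strongly acceptable»); here `Γ` is
an arbitrary group — homomorphisms `φ, ψ : Γ → SO(4)` that are ELEMENT-CONJUGATE (`ψ(γ) ∼ φ(γ)` for every `γ`) are GLOBALLY
conjugate: `ψ = y φ y⁻¹` for one `y ∈ SO(4)`. [cite: Yu2021, Thm 1.1 and Thm 4.1(3) (SO(4) is (strongly) acceptable); Larsen1994, §0 (definition of acceptable)] -/
theorem exists_conj_of_forall_isConj {Γ : Type*} [Group Γ] (φ ψ : Γ →* Matrix.specialOrthogonalGroup (Fin 4) ℝ)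
    (h : ∀ γ, IsConj (φ γ) (ψ γ)) : ∃ y : Matrix.specialOrthogonalGroup (Fin 4) ℝ, ∀ γ, ψ γ = y * φ γ * y⁻¹ := by
  refine specialOrthogonalGroup_four_exists_conj_of_prod_conj ⇑φ ⇑ψ fun l _ => ?_
  obtain ⟨c, hc⟩ := isConj_iff.1 (h l.prod)
  exact ⟨c, by rw [← map_list_prod, ← map_list_prod, hc]⟩

/-- The same for families: **word-wise `SO(4)`-conjugate families are simultaneously conjugate** (all words, inverses
allowed — in particular for the non-empty positive ones used by the theorem). [cite: Yu2021, Thm 1.1 (SO(4) acceptable, Γ free)] -/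
theorem exists_conj_of_forall_prod_isConj (V W : ι → Matrix.specialOrthogonalGroup (Fin 4) ℝ)
    (h : ∀ l : List ι, IsConj (l.map V).prod (l.map W).prod) :
    ∃ y : Matrix.specialOrthogonalGroup (Fin 4) ℝ, ∀ i, W i = y * V i * y⁻¹ := by
  refine specialOrthogonalGroup_four_exists_conj_of_prod_conj V W fun l _ => ?_
  obtain ⟨c, hc⟩ := isConj_iff.1 (h l)
  exact ⟨c, hc.symm⟩

end Main

end Literature.LinearAlgebra.Matrix.SimultaneousConjugacySO4
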